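import Mathlib
import HarnessLib.Audit
import Summits.PneNP.PneNP.Theorems.PstarNorUnitDirection
import Summits.PneNP.PneNP.Theorems.PstarUnionEQ1Witness
import Summits.PneNP.PneNP.Theorems.PstarUnionCornerWitness
import Summits.PneNP.PneNP.Theorems.PstarUnionSingleRelease
import Summits.PneNP.PneNP.Theorems.PstarUnionBridgeData
import Summits.PneNP.PneNP.Theorems.PstarUnionTrichotomy

/-!
# Case B of the union lemma with a single chord: `#J₀ ≤ 5` (ROUND-24, memo §14.21–§14.22; toward `CaseBFive`)

FRONTIER range-avoidance ladder, rung F-N3, ROUND 24 (cell `pnp-ideate`, planner memo `r24/CORE-BOUND-NOTES.md` §14.21–§14.22 (Case B, single-chord world); restricted-model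
proof complexity — nothing here bears on `P` versus `NP`).

* `single_chord_core` — bridge data with ONE chord `c₀`, chord-minimal at `c₀`, (T3), lift, hun, and ONE path edge `j ∈ D c₀` released in the same system ⟹ `#J₀ ≤ 5`:
  `PstarChordBridgeKill.regime_cases` (minimality at chords only) puts the system in the (U2) corner (`PstarUnionCornerWitness.card_eq_three_of_corner'`) or in the direction
  picture — (NOR) `PstarNorUnitFinal.card_le_five_of_regime_nor`, (EXC) `PstarNorUnitDirection.unit_or_EQ_of_exc`, (EQ) `PstarUnionEQ1Witness.eq1_one_witness`;
* `caseB_single_chord` — **union-terminal core, admissible `F`, hun, `w₂` reading a chord private, at most one chord ⟹ `#J₀ ≤ 5`**: the reader `R` released by the chord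
  `c₀` is released by some path edge (then `single_chord_core`), or every path edge releases the other reader `R′`, which then releases `c₀` too (the pair `(R′, w₂)` is
  TERMINAL: `PstarCoreBoundTargets.card_le_five_of_terminal'`) — `R′` released by a path edge but not by `c₀` is impossible (`PstarUnionSingleRelease.false_of_path_release`).
-/

set_option linter.dupNamespace false -- `Summit.PneNP.PneNP.…`: summit = sub-problem name (D-0017 single-conjunct layout)

open Finset Module Literature.Computability.Complexity
open Summit.PneNP.PneNP.Theorems.PstarFibrePolys (bit bit_injective)
open Summit.PneNP.PneNP.Theorems.PstarTyped (Typed)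
open Summit.PneNP.PneNP.Theorems.PstarSALevel (varSet bdry BoundaryExpanding SimpleOverlap)
open Summit.PneNP.PneNP.Theorems.PstarCoreBound (XorClosed)
open Summit.PneNP.PneNP.Theorems.PstarGapLinearised (andPair)
open Summit.PneNP.PneNP.Theorems.PstarGapOneAll (gval)
open Summit.PneNP.PneNP.Theorems.PstarCubeIdeals (IsAffineFn)
open Summit.PneNP.PneNP.Theorems.PstarProductRank (qform polar)
open Summit.PneNP.PneNP.Theorems.PstarPathRank (AndAdj)
open Summit.PneNP.PneNP.Theorems.PstarChordRepair (IsChord)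
open Summit.PneNP.PneNP.Theorems.PstarChordSystem (ChordSystem)
open Summit.PneNP.PneNP.Theorems.PstarChordBridgeTools
open Summit.PneNP.PneNP.Theorems.PstarChordBridge
open Summit.PneNP.PneNP.Theorems.PstarReadSumset (V2)
open Summit.PneNP.PneNP.Theorems.PstarChordBridgeFundamental (two_le_card_of_even)
open Summit.PneNP.PneNP.Theorems.PstarChordBridgeForcing (gam const_of_unread)
open Summit.PneNP.PneNP.Theorems.PstarChordBridgeCotree (Peelable sdiff_nonempty_of_xorClosed)
open Summit.PneNP.PneNP.Theorems.PstarChordBridgeTerminal (HasConstraints)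
open Summit.PneNP.PneNP.Theorems.PstarChordBridgeBasis (qDir polarDir)
open Summit.PneNP.PneNP.Theorems.PstarChordBridgeCorner (qDir_add)
open Summit.PneNP.PneNP.Theorems.PstarChordBridgeKill (regime_cases)
open Summit.PneNP.PneNP.Theorems.PstarNorUnitDirection (unit_or_EQ_of_exc)
open Summit.PneNP.PneNP.Theorems.PstarNorUnitFinal (card_le_five_of_regime_nor)
open Summit.PneNP.PneNP.Theorems.PstarNorUnitRegime (J₀_eq_of_single)
open Summit.PneNP.PneNP.Theorems.PstarCoreBoundTargets (Terminal card_le_five_of_terminal')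
open Summit.PneNP.PneNP.Theorems.PstarUnion (SatPair UnionTerminal)
open Summit.PneNP.PneNP.Theorems.PstarUnionBridgeData (exists_bridgeData_of_sat)
open Summit.PneNP.PneNP.Theorems.PstarUnionEQ1Witness (eq1_one_witness)
open Summit.PneNP.PneNP.Theorems.PstarUnionCornerWitness (card_eq_three_of_corner')
open Summit.PneNP.PneNP.Theorems.PstarUnionSingleRelease (false_of_path_release)

namespace Summit.PneNP.PneNP.Theorems.PstarUnionCaseBSingle

variable {n m : ℕ}

/-- **One chord, chord-minimal, one path witness ⟹ `#J₀ ≤ 5`.** -/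
theorem single_chord_core (I : LocalMap 4 n m) (hI : I.IsPure xorAndPred) (hT : Typed I) (hS : SimpleOverlap I) {r : ℕ}
    (hB : BoundaryExpanding r I) {B : BridgeData n m} (hW : B.WF I) (hJr : B.J₀.card < r) (hr : (B.J₀ ∪ B.G₁ ∪ B.G₂).card ≤ r)
    (hX : XorClosed I B.J₀) (hP : Peelable I (B.J₀ \ B.N)) (hG₁ : Disjoint B.G₁ B.J₀) (hG₂ : Disjoint B.G₂ B.J₀) (hL : Lift I B)
    (hun : ∀ v ∈ privs I B.N, (∀ g ∈ B.G₁, I.vars g 2 ≠ v ∧ I.vars g 3 ≠ v) ∧ ∀ g ∈ B.G₂, I.vars g 2 ≠ v ∧ I.vars g 3 ≠ v)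
    (hT3 : ¬ ∃ z, Solution I B B.J₀ z) {c₀ : Fin m} (hN : B.N = {c₀}) (hmin : ∃ z, Solution I B (B.J₀.erase c₀) z)
    {j : Fin m} (hj : j ∈ B.D c₀) {z : Fin n → Bool} (hz : Solution I B (B.J₀.erase j) z) : B.J₀.card ≤ 5 := by
  classical
  have hc₀ : c₀ ∈ B.N := by rw [hN]; exact mem_singleton_self _
  have hc₀D : c₀ ∉ B.D c₀ := fun h => (mem_sdiff.1 (hW.hD c₀ hc₀ h)).2 hc₀
  have hNne : B.N.Nonempty := ⟨c₀, hc₀⟩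
  have hJ : B.J₀ = insert c₀ (B.D c₀) := J₀_eq_of_single I hI hT hW hX hP hN
  have hM0N : ∀ e ∈ B.N, ∃ z, Solution I B (B.J₀.erase e) z := by
    intro e he
    rw [hN, mem_singleton] at he
    rw [he]; exact hmin
  rcases regime_cases I hI hT hS hB hW hJr.le hL hun hT3 hM0N with ⟨e₀, hNe, h1, h2, h3⟩ | ⟨mv, hmv, hreads, hall⟩
  · -- the (U2) corner: a triangle
    have he₀ : e₀ = c₀ := by
      have : c₀ ∈ ({e₀} : Finset (Fin m)) := hNe ▸ hc₀
      exact (mem_singleton.1 this).symm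
    subst he₀
    have h3' := card_eq_three_of_corner' I hI hT hS hB hW hr hG₁ hG₂ hL hun hT3 hNe hJ h1 h2 h3 hj hz
    omega
  · -- the direction picture
    have hinf : (sys I B).Infeasible B.N := infeasible_of_not_solution I hI hT hW hL hT3
    have hminS : (sys I B).ChordMinimal B.N c₀ := by
      obtain ⟨z0, hz0⟩ := hmin
      exact chordMinimal_of_solution_erase I hI hT hW hc₀ hz0
    have hconst := const_of_unread I B hun
    have hU1 : ∀ e a, ((sys I B).ρ e a = 0 ∨ (sys I B).ρ e a = mv) ∧ ((sys I B).ρ' e a = 0 ∨ (sys I B).ρ' e a = mv) := by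
      intro e a
      by_cases he : e ∈ B.N
      · rw [(hconst e a 0).1, (hconst e a 0).2]; exact hreads e he
      · rw [(sys_ρ_of_not_mem I B he a).1, (sys_ρ_of_not_mem I B he a).2]; exact ⟨Or.inl rfl, Or.inl rfl⟩
    have heG : c₀ ∉ B.G₁ ∪ B.G₂ := fun h => by
      rcases mem_union.1 h with h | h
      · exact Finset.disjoint_left.1 hG₁ h (hW.hN hc₀)
      · exact Finset.disjoint_left.1 hG₂ h (hW.hN hc₀)
    -- (EQ) at `c₀` closes by the one-witness EQ1 corner
    have hEQcase : ∀ κ : ZMod 2, (∀ x, qform (B.D c₀) (fun j => I.vars j 2) (fun j => I.vars j 3) x = qDir I B mv x + κ) → B.J₀.card ≤ 5 := by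
      intro κ hκ
      have h3 := eq1_one_witness I hI hT hS hB hW hr hX hP hG₁ hG₂ hL hun hT3 hmv hreads hN hκ hmin hj hz
      omega
    rcases hall c₀ hc₀ with ⟨κ, hκ⟩ | ⟨ν₁, ν₂, hν₁, hν₂, κ, h⟩ | hnor
    · exact hEQcase κ hκ
    · rcases unit_or_EQ_of_exc I hI hS hB hW hr hc₀ heG hmv hU1 hconst hinf hminS hν₁ hν₂ h with ⟨κ', hκ'⟩ | ⟨j₁, j₂, σ, τ, hne, hDe, -⟩
      · exact hEQcase κ' hκ'
      · rw [hJ, card_insert_of_notMem hc₀D, hDe, card_pair hne]; omega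
    · refine card_le_five_of_regime_nor I hI hT hS hB hW hr hJr hX hP hG₁ hG₂ hNne mv fun e he => ?_
      rw [hN, mem_singleton] at he
      rw [he]; exact hnor

/-- **Case B, at most one chord: `#J₀ ≤ 5`.** -/
theorem caseB_single_chord (I : LocalMap 4 n m) (hI : I.IsPure xorAndPred) (hT : Typed I) (hS : SimpleOverlap I) {r : ℕ} (hE : BoundaryExpanding r I)
    {y : Fin m → Bool} {J₀ : Finset (Fin m)} {A₀ A₁ w₂ : Finset (Fin n) × Finset (Fin m) × Bool} (hU : UnionTerminal I r y J₀ A₀ A₁ w₂)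
    {F : Finset (Fin m)} (hF : F ⊆ J₀) (hP : Peelable I F) (hmax : ∀ F', F ⊆ F' → F' ⊆ J₀ → Peelable I F' → F' = F)
    (hchord : ∀ e ∈ J₀ \ F, IsChord I J₀ e) (hun : ∀ g ∈ A₀.2.1 ∪ w₂.2.1, ∀ v ∈ privs I (J₀ \ F), I.vars g 2 ≠ v ∧ I.vars g 3 ≠ v)
    (hread : ∃ v ∈ privs I (J₀ \ F), v ∈ w₂.1) (hone : (J₀ \ F).card ≤ 1) : J₀.card ≤ 5 := by
  classical
  have hU' := hU
  obtain ⟨hne, hX, hJr, hG, hd₀, hd₂, hcard, -, hn₀, hn₁, hcov⟩ := hU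
  -- the unique chord `c₀`
  obtain ⟨c₀, hc₀⟩ := sdiff_nonempty_of_xorClosed I hT hX hne hF hP
  have hNeq : J₀ \ F = {c₀} := eq_singleton_iff_unique_mem.2 ⟨hc₀, fun c hc => by
    by_contra hcc
    have : 2 ≤ (J₀ \ F).card := by
      have : ({c, c₀} : Finset (Fin m)) ⊆ J₀ \ F := by
        intro x hx; rw [mem_insert, mem_singleton] at hx; rcases hx with rfl | rfl; exact hc; exact hc₀
      have h2 : ({c, c₀} : Finset (Fin m)).card = 2 := card_pair hcc
      exact h2 ▸ card_le_card this
    omega⟩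
  have hc₀J : c₀ ∈ J₀ := (mem_sdiff.1 hc₀).1
  have hread₀ : I.vars c₀ 2 ∈ w₂.1 ∨ I.vars c₀ 3 ∈ w₂.1 := by
    obtain ⟨v, hv, hvw⟩ := hread
    obtain ⟨c, hc, h⟩ := (mem_privs I).1 hv
    rw [hNeq, mem_singleton] at hc
    subst hc
    rcases h with h | h
    · left; rw [h]; exact hvw
    · right; rw [h]; exact hvw
  have hun₁ : ∀ g ∈ A₁.2.1 ∪ w₂.2.1, ∀ v ∈ privs I (J₀ \ F), I.vars g 2 ≠ v ∧ I.vars g 3 ≠ v := by rw [hG]; exact hun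
  -- the generic step for an ordered pair of readers `(R, R')` with `R` released by the chord
  have main : ∀ R R' : Finset (Fin n) × Finset (Fin m) × Bool,
      Disjoint J₀ R.2.1 → Disjoint J₀ R'.2.1 → (J₀ ∪ R.2.1 ∪ w₂.2.1).card ≤ r → (J₀ ∪ R'.2.1 ∪ w₂.2.1).card ≤ r →
      (∀ g ∈ R.2.1 ∪ w₂.2.1, ∀ v ∈ privs I (J₀ \ F), I.vars g 2 ≠ v ∧ I.vars g 3 ≠ v) →
      (∀ g ∈ R'.2.1 ∪ w₂.2.1, ∀ v ∈ privs I (J₀ \ F), I.vars g 2 ≠ v ∧ I.vars g 3 ≠ v) →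
      ¬ SatPair I y J₀ R w₂ → ¬ SatPair I y J₀ R' w₂ →
      (∀ f ∈ J₀, SatPair I y (J₀.erase f) R w₂ ∨ SatPair I y (J₀.erase f) R' w₂) →
      SatPair I y (J₀.erase c₀) R w₂ → J₀.card ≤ 5 := by
    intro R R' hdR hdR' hcR hcR' hunR hunR' hT3R hT3R' hcv hRc
    have hcrossR : ∀ g ∈ R.2.1 ∪ w₂.2.1, ¬ (I.vars g 2 ∈ privs I (J₀ \ F) ∧ I.vars g 3 ∈ privs I (J₀ \ F)) :=
      fun g hg h => (hunR g hg _ h.1).1 rfl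
    have hT3R0 : ¬ ∃ z : Fin n → Bool, (∀ j ∈ J₀, I.eval z j = y j) ∧ gval I R.1 R.2.1 z = R.2.2 ∧ gval I w₂.1 w₂.2.1 z = w₂.2.2 := hT3R
    obtain ⟨zc, -, hzc1, hzc2⟩ := id hRc
    obtain ⟨B, hy, hJ, hN, ⟨hC1, hG1, hb1, hC2, hG2, hb2⟩, hW, hL, -⟩ :=
      exists_bridgeData_of_sat I hI hT hS hE y hJr.le R w₂ hdR hd₂ hT3R0 ⟨zc, hzc1, hzc2⟩ hF hP hmax hchord hcrossR
    subst hy hJ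
    have hNB : B.N = {c₀} := by rw [hN, hNeq]
    have hc₀N : c₀ ∈ B.N := by rw [hNB]; exact mem_singleton_self _
    have hFN : B.J₀ \ B.N = F := by rw [hN]; exact Finset.sdiff_sdiff_eq_self hF
    have hJeq : B.J₀ = insert c₀ (B.D c₀) := J₀_eq_of_single I hI hT hW hX (by rw [hFN]; exact hP) hNB
    have hc₀D : c₀ ∉ B.D c₀ := fun h => (mem_sdiff.1 (hW.hD c₀ hc₀N h)).2 hc₀N
    have hFD : ∀ f ∈ F, f ∈ B.D c₀ := by
      intro f hf
      have hfJ : f ∈ B.J₀ := hF hf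
      rw [hJeq, mem_insert] at hfJ
      rcases hfJ with h | h
      · rw [h] at hf; exact absurd hf (mem_sdiff.1 hc₀).2
      · exact h
    have hunB : ∀ v ∈ privs I B.N, (∀ g ∈ B.G₁, I.vars g 2 ≠ v ∧ I.vars g 3 ≠ v) ∧ ∀ g ∈ B.G₂, I.vars g 2 ≠ v ∧ I.vars g 3 ≠ v := by
      intro v hv
      rw [hN] at hv
      rw [hG1, hG2]
      exact ⟨fun g hg => hunR g (mem_union_left _ hg) v hv, fun g hg => hunR g (mem_union_right _ hg) v hv⟩
    have hT3B : ¬ ∃ z, Solution I B B.J₀ z := by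
      rintro ⟨z, hz, h1, h2⟩
      rw [hC1, hG1, hb1] at h1
      rw [hC2, hG2, hb2] at h2
      exact hT3R ⟨z, hz, h1, h2⟩
    have hsol : ∀ {E : Finset (Fin m)}, SatPair I B.y E R w₂ → ∃ z, Solution I B E z := by
      rintro E ⟨z, hz, h1, h2⟩
      refine ⟨z, hz, ?_, ?_⟩
      · rw [hC1, hG1, hb1]; exact h1
      · rw [hC2, hG2, hb2]; exact h2
    -- does a path edge release `R`?
    by_cases hfR : ∃ f ∈ F, SatPair I B.y (B.J₀.erase f) R w₂
    · obtain ⟨f, hf, hsf⟩ := hfR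
      obtain ⟨z, hz⟩ := hsol hsf
      have hr' : (B.J₀ ∪ B.G₁ ∪ B.G₂).card ≤ r := by rw [hG1, hG2]; exact hcR
      exact single_chord_core I hI hT hS hE hW hJr hr' hX (by rw [hFN]; exact hP) (by rw [hG1]; exact hdR.symm) (by rw [hG2]; exact hd₂.symm)
        hL hunB hT3B hNB (hsol hRc) (hFD f hf) hz
    · -- every path edge releases `R'`
      have hF' : ∀ f ∈ F, SatPair I B.y (B.J₀.erase f) R' w₂ := fun f hf =>
        (hcv f (hF hf)).resolve_left fun h => hfR ⟨f, hf, h⟩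
      by_cases hR'c : SatPair I B.y (B.J₀.erase c₀) R' w₂
      · -- `(R', w₂)` is terminal
        have hTm : Terminal I r B.y B.J₀ R' w₂ := by
          refine ⟨hne, hX, hJr, hdR', hd₂, hcR', hT3R', fun f hf => ?_⟩
          by_cases hfc : f = c₀
          · rw [hfc]; exact hR'c
          · exact hF' f (by
              have : f ∈ B.J₀ \ (B.J₀ \ F) := by
                rw [hNeq]; exact mem_sdiff.2 ⟨hf, by rw [mem_singleton]; exact hfc⟩
              rw [Finset.sdiff_sdiff_eq_self hF] at this
              exact this)
        exact card_le_five_of_terminal' I hI hT hS hE B.y hTm hF hP hmax hchord hunR'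
      · -- `R'` released by a path edge but not by the chord: impossible
        exfalso
        have hD2 : 2 ≤ (B.D c₀).card := two_le_card_of_even I hI hS hc₀D (hW.hDeven c₀ hc₀N)
        obtain ⟨f, hf⟩ : (B.D c₀).Nonempty := card_pos.1 (by omega)
        have hfF : f ∈ F := by rw [← hFN]; exact hW.hD c₀ hc₀N hf
        obtain ⟨zf, hzfK, hzf1, hzf2⟩ := hF' f hfF
        have hcrossR' : ∀ g ∈ R'.2.1 ∪ w₂.2.1, ¬ (I.vars g 2 ∈ privs I (B.J₀ \ F) ∧ I.vars g 3 ∈ privs I (B.J₀ \ F)) :=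
          fun g hg h => (hunR' g hg _ h.1).1 rfl
        have hT3R'0 : ¬ ∃ z : Fin n → Bool, (∀ j ∈ B.J₀, I.eval z j = B.y j) ∧ gval I R'.1 R'.2.1 z = R'.2.2 ∧ gval I w₂.1 w₂.2.1 z = w₂.2.2 :=
          hT3R'
        obtain ⟨B', hy', hJ', hN', ⟨hC1', hG1', hb1', hC2', hG2', hb2'⟩, hW', hL', -⟩ :=
          exists_bridgeData_of_sat I hI hT hS hE B.y hJr.le R' w₂ hdR' hd₂ hT3R'0 ⟨zf, hzf1, hzf2⟩ hF hP hmax hchord hcrossR'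
        have hNB' : B'.N = {c₀} := by rw [hN', hNeq]
        have hunB' : ∀ v ∈ privs I B'.N, (∀ g ∈ B'.G₁, I.vars g 2 ≠ v ∧ I.vars g 3 ≠ v) ∧ ∀ g ∈ B'.G₂, I.vars g 2 ≠ v ∧ I.vars g 3 ≠ v := by
          intro v hv
          rw [hN'] at hv
          rw [hG1', hG2']
          exact ⟨fun g hg => hunR' g (mem_union_left _ hg) v hv, fun g hg => hunR' g (mem_union_right _ hg) v hv⟩
        have hT3B' : ¬ ∃ z, Solution I B' B'.J₀ z := by
          rintro ⟨z, hz, h1, h2⟩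
          rw [hC1', hG1', hb1'] at h1
          rw [hC2', hG2', hb2'] at h2
          rw [hJ', hy'] at hz
          exact hT3R' ⟨z, hz, h1, h2⟩
        have hreadsB' : I.vars c₀ 2 ∈ B'.C₂ ∨ I.vars c₀ 3 ∈ B'.C₂ := by rw [hC2']; exact hread₀
        have hnc : ¬ ∃ z, Solution I B' (B'.J₀.erase c₀) z := by
          rintro ⟨z, hz, h1, h2⟩
          rw [hC1', hG1', hb1'] at h1
          rw [hC2', hG2', hb2'] at h2
          rw [hJ', hy'] at hz
          exact hR'c ⟨z, hz, h1, h2⟩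
        -- the same fundamental set: `D' c₀ = F = D c₀` up to the witness `f ∈ F`
        have hc₀N' : c₀ ∈ B'.N := by rw [hNB']; exact mem_singleton_self _
        have hFN' : B'.J₀ \ B'.N = F := by rw [hN', hJ']; exact Finset.sdiff_sdiff_eq_self hF
        have hJeq' : B'.J₀ = insert c₀ (B'.D c₀) := J₀_eq_of_single I hI hT hW' (by rw [hJ']; exact hX) (by rw [hFN']; exact hP) hNB'
        have hfD' : f ∈ B'.D c₀ := by
          have hfJ : f ∈ B'.J₀ := by rw [hJ']; exact hF hfF
          rw [hJeq', mem_insert] at hfJ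
          rcases hfJ with h | h
          · rw [h] at hfF; exact absurd hfF (mem_sdiff.1 hc₀).2
          · exact h
        have hzS : Solution I B' (B'.J₀.erase f) zf := by
          refine ⟨by rw [hJ', hy']; exact hzfK, ?_, ?_⟩
          · rw [hC1', hG1', hb1']; exact hzf1
          · rw [hC2', hG2', hb2']; exact hzf2
        exact false_of_path_release I hI hT hS hW' hL' (by rw [hG1', hJ']; exact hdR'.symm) (by rw [hG2', hJ']; exact hd₂.symm)
          hunB' hT3B' hNB' hreadsB' hnc hfD' hzS
  -- apply the generic step to the reader released by `c₀`
  have hd₁ : Disjoint J₀ A₁.2.1 := by rw [hG]; exact hd₀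
  have hcard₁ : (J₀ ∪ A₁.2.1 ∪ w₂.2.1).card ≤ r := by rw [hG]; exact hcard
  rcases hcov c₀ hc₀J with h | h
  · exact main A₀ A₁ hd₀ hd₁ hcard hcard₁ hun hun₁ hn₀ hn₁ hcov h
  · exact main A₁ A₀ hd₁ hd₀ hcard₁ hcard hun₁ hun hn₁ hn₀ (fun f hf => (hcov f hf).symm) h

end Summit.PneNP.PneNP.Theorems.PstarUnionCaseBSingle
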